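import Literature.Geometry.DiscreteGeometry.ThreePointEnergyBound
import Summits.Ventures.PackingBounds.Energy.ChebyshevUExplicit
import Summits.Ventures.PackingBounds.Energy.TenPointCkFourSOS
import Summits.Ventures.PackingBounds.Energy.TenPointCkFourFsum
import Summits.Ventures.PackingBounds.Energy.TenPointCkFourBound
import HarnessLib

/-!
# Ten points on `S³`: the sharp bound `435/4` for `Σ (1 + ⟪x,y⟫)^4` by an exact three-point certificate

Framing: lottery ticket; floor = certified bounds/negative ranges. Venture `PackingBounds`, cell
`pub-packcert`, energy family E3PT (pub-packcert-energy gen 14; n = 4 kernel route = KERNEL-D6 data route + `threePointF 4`).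

For every set `C` of ten unit vectors of `ℝ⁴`, `Σ_{x ≠ y} (1 + ⟪x,y⟫)^4` over ordered pairs is at least `435/4`, the value of
two orthogonal regular pentagons (4,10) (inner products `0`, `(√5-1)/4`, `-(√5+1)/4`). Cohn–Woo (J. AMS 2012, §5.3) report this case of their three-point bound as
numerically sharp; no proof or certificate is printed there. The proof here is an exact sharp Bachoc–Vallentin / Cohn–Woo
three-point certificate (rational: the optimal face is Galois-stable), kernel-checked: `CohnWoo.energy_ge_of_threePoint` (general `n`),
`tripleSum_threePointF_nonneg` (`n = 4`), the blockwise identities `threePointF 4 … = FexpKW4` (closed forms `QFour.Q4_<k>`), the two-point part in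
the basis `C_k^1 = U_k` (`ChebyshevU.c1_k`, k ≤ 6), the SOS identity of the companion files, and the PSD of the 72 × 72 Gram block by kernel
evaluation on integer data (KERNEL-D6 route).
Source certificate `pub-packcert-energy/certs/e3pt/e3pt-sharp-n4N10ck4d6-rat.json`; generator `pub-packcert-energy/code/e3pt/g14/e3pt_lean_n4p.py`.
-/

noncomputable section

open Finset
open scoped RealInnerProductSpace

namespace Summit.Ventures.PackingBounds.Energy.TenPointCkFour

open Literature.Geometry.DiscreteGeometry Literature.Geometry.DiscreteGeometry.BachocVallentin
open Literature.Analysis.SpecialFunctions Summit.Ventures.PackingBounds.Energy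

/-- Two-point coefficients in the tree's basis `C_k^1 = U_k` (`U_k(1) = k+1`): `a_k/(k+1)`. -/
def acoKW4 : ℕ → ℝ
  | 1 => aKW4 1 / 2
  | 2 => aKW4 2 / 3
  | 3 => aKW4 3 / 4
  | 6 => aKW4 6 / 7
  | _ => 0

/-- The two-point coefficients are nonnegative. -/
theorem aco_nonnegW4 (k : ℕ) : 0 ≤ acoKW4 k := by
  unfold acoKW4; split
  · exact div_nonneg (aK_nonnegW4 _) (by norm_num)
  · exact div_nonneg (aK_nonnegW4 _) (by norm_num)
  · exact div_nonneg (aK_nonnegW4 _) (by norm_num)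
  · exact div_nonneg (aK_nonnegW4 _) (by norm_num)
  · norm_num

/-- The rank-one weights are nonnegative. -/
theorem dco_nonnegW4 (k r : ℕ) : 0 ≤ dcoKW4 k r := by
  unfold dcoKW4; split
  · exact dco0B_nonnegW4 _
  · exact dco1B_nonnegW4 _
  · exact dco2B_nonnegW4 _
  · exact dco3B_nonnegW4 _
  · exact dco4B_nonnegW4 _
  · exact dco5B_nonnegW4 _
  · exact dco6B_nonnegW4 _
  · norm_num

/-- **Ten points on `S³` (sharp three-point bound).** For every ten unit vectors `C ⊂ ℝ⁴`, `Σ_{x ≠ y} (1 + ⟪x,y⟫)^4` over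
ordered pairs is `≥ 435/4` — the value of two orthogonal regular pentagons (4,10). -/
theorem ck4_ten_points (C : Finset (EuclideanSpace ℝ (Fin 4))) (hC : ∀ x ∈ C, ‖x‖ = 1)
    (h10 : C.card = 10) :
    ((435 : ℝ)/4) ≤ ∑ x ∈ C, ∑ y ∈ C.erase x, (1 + inner ℝ x y) ^ 4 := by
  classical
  have hA := pairSum_gegenbauer_comb_nonneg (n := 4) (by norm_num) 6 acoKW4 aco_nonnegW4 C hC
  have hF := tripleSum_threePointF_nonneg (n := 4) le_rfl 7 6 dcoKW4 dco_nonnegW4 gwKW4 C hC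
  have hcard : (C.card : ℝ) = 10 := by exact_mod_cast h10
  have hAeval : ∀ w : ℝ, (∑ k ∈ range (6 + 1), acoKW4 k * gegenbauerSum ((((4 : ℕ) : ℝ) - 2) / 2) k w) = aPolyKW4 w := by
    intro w
    have hμ : ((((4 : ℕ) : ℝ) - 2) / 2) = (1 : ℝ) := by norm_num
    rw [hμ]
    have h0 : acoKW4 0 = 0 := rfl
    have h1 : acoKW4 1 = (((399592627704909584981803 : ℝ)/2966193212496073143091200)) / 2 := rfl
    have h2 : acoKW4 2 = (((1752310931943086940223 : ℝ)/87887206296179944980480)) / 3 := rfl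
    have h3 : acoKW4 3 = (((536261332172047320281 : ℝ)/13732375983778116403200)) / 4 := rfl
    have h4 : acoKW4 4 = 0 := rfl
    have h5 : acoKW4 5 = 0 := rfl
    have h6 : acoKW4 6 = (((1628079691718364185 : ℝ)/470824319443821133824)) / 7 := rfl
    simp only [Finset.sum_range_succ, Finset.sum_range_zero, h0, h1, h2, h3, h4, h5, h6, ChebyshevU.c1_0, ChebyshevU.c1_1, ChebyshevU.c1_2, ChebyshevU.c1_3, ChebyshevU.c1_4, ChebyshevU.c1_5, ChebyshevU.c1_6, aPolyKW4]
    ring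
  have hineq : ∀ u v t : ℝ, -1 ≤ u → u < 1 → -1 ≤ v → v < 1 → -1 ≤ t → t < 1 →
      0 ≤ 1 + 2 * u * v * t - u ^ 2 - v ^ 2 - t ^ 2 →
      c0KW4 + ((C.card : ℝ) - 2) * threePointF 4 7 6 dcoKW4 gwKW4 u v t + threePointF 4 7 6 dcoKW4 gwKW4 u u 1
        + threePointF 4 7 6 dcoKW4 gwKW4 v v 1 + threePointF 4 7 6 dcoKW4 gwKW4 t t 1
        + ((fun w => ∑ k ∈ range (6 + 1), acoKW4 k * gegenbauerSum ((((4 : ℕ) : ℝ) - 2) / 2) k w) u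
          + (fun w => ∑ k ∈ range (6 + 1), acoKW4 k * gegenbauerSum ((((4 : ℕ) : ℝ) - 2) / 2) k w) v
          + (fun w => ∑ k ∈ range (6 + 1), acoKW4 k * gegenbauerSum ((((4 : ℕ) : ℝ) - 2) / 2) k w) t) / 3
        ≤ (pminKW4 u + pminKW4 v + pminKW4 t) / 3 := by
    intro u v t hu1 hu2 hv1 hv2 ht1 ht2 hdet
    simp only [hAeval, hcard, threePointF_eqW4]
    have h1 := slack_nonnegW4 u v t
    linarith
  have key := CohnWoo.energy_ge_of_threePoint C hC (by omega) pminKW4 _ _ c0KW4 hA hF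
    (threePointF_swap12 4 7 6 dcoKW4 gwKW4) (threePointF_swap23 4 7 6 dcoKW4 gwKW4) hineq
  simp only [hAeval, hcard, threePointF_eqW4] at key
  have hfin : ∑ x ∈ C, ∑ y ∈ C.erase x, pminKW4 (inner ℝ x y) = ∑ x ∈ C, ∑ y ∈ C.erase x, (1 + inner ℝ x y) ^ 4 :=
    Finset.sum_congr rfl fun x _ => Finset.sum_congr rfl fun y _ => by simp only [pminKW4]; ring
  rw [hfin] at key
  linarith [key, bound_eqW4]

end Summit.Ventures.PackingBounds.Energy.TenPointCkFour
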